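import Literature.AlgebraicGeometry.Resolution.RegularLocalRingsJacobian
import Summits.ResolutionOfSingularities.ResolutionOfSingularities.Theorems.FrobeniusLadderFInjectiveMacaulayficationFedderOrigin
import Summits.ResolutionOfSingularities.ResolutionOfSingularities.Theorems.FrobeniusLadderFInjectiveMacaulayficationThreefoldChart3Points
import Mathlib.Algebra.MvPolynomial.PDeriv
import HarnessLib

/-!
# Threefold calibration: the origin of the `X₃`-chart is a singular point of `g₃ = 0`

Sublemma for `Summit.ResolutionOfSingularities.ResolutionOfSingularities.Theses.FrobeniusLadder.FInjectiveMacaulayfication`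
(line Sketch, threefold calibration in dimension `3`, characteristic `2`).

The strict transform, on the `X₃`-chart of the blow-up of the origin, of the germ
`f = X₀²X₁ + X₁²X₂ + X₂²X₀ + X₀X₃³ + X₁X₂X₃²` is
`g₃ = X₀²X₁ + X₁²X₂ + X₂²X₀ + X₀X₃ + X₁X₂X₃ ∈ k[X₀, X₁, X₂, X₃]`. The origin of this chart passes
Fedder's test (`ThreefoldChart3Points.stub_threefoldChart3Points`), but it is **not** a regular point
of the hypersurface `g₃ = 0`: `g₃(0) = 0` and all partial derivatives
`∂₀g₃ = 2X₀X₁ + X₂² + X₃`, `∂₁g₃ = X₀² + 2X₁X₂ + X₂X₃`, `∂₂g₃ = X₁² + 2X₂X₀ + X₁X₃`,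
`∂₃g₃ = X₀ + X₁X₂` have no constant term, so they vanish at `0` (over any field, no characteristic
hypothesis). The Jacobian criterion in the singular direction
(`Literature.AlgebraicGeometry.Resolution.not_isRegularLocalRing_localization_of_pderiv_eval_eq_zero`,
[Hartshorne1977] I Thm. 5.1 with [Matsumura1987] Thm. 14.2) then says that for every prime `Q` of
`k[X]/(g₃)` lying over `(X₀, X₁, X₂, X₃) = ker (eval 0)` the local ring `(k[X]/(g₃))_Q` is not regular.

References: [Hartshorne1977] R. Hartshorne, Algebraic Geometry, GTM 52, I Thm. 5.1;
[Matsumura1987] H. Matsumura, Commutative Ring Theory, Thm. 14.2.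
-/

-- single-problem summit: the doubled namespace component is forced
set_option linter.dupNamespace false

noncomputable section

namespace Summit.ResolutionOfSingularities.ResolutionOfSingularities.Theorems.FInjectiveMacaulayfication.ThreefoldChart3OriginSingular

open MvPolynomial
open Summit.ResolutionOfSingularities.ResolutionOfSingularities.Theorems.FInjectiveMacaulayfication

/-- **`g₃(0) = 0`**: `g₃ = X₀²X₁ + X₁²X₂ + X₂²X₀ + X₀X₃ + X₁X₂X₃` has no constant term. [folklore] -/
theorem eval_zero_g3 (k : Type) [Field k] :
    eval (0 : Fin 4 → k)
      (X 0 ^ 2 * X 1 + X 1 ^ 2 * X 2 + X 2 ^ 2 * X 0 + X 0 * X 3 + X 1 * X 2 * X 3 :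
        MvPolynomial (Fin 4) k) = 0 := by
  simp only [map_add, map_mul, map_pow, eval_X, Pi.zero_apply, mul_zero, add_zero]

/-- **`∇g₃(0) = 0`**: every partial derivative of `g₃ = X₀²X₁ + X₁²X₂ + X₂²X₀ + X₀X₃ + X₁X₂X₃`
vanishes at the origin — by the Leibniz rule each term of `∂ᵢg₃` keeps a factor `Xⱼ` (every monomial
of `g₃` has degree `≥ 2`), over any field. [folklore] -/
theorem eval_zero_pderiv_g3 (k : Type) [Field k] (i : Fin 4) :
    eval (0 : Fin 4 → k) (pderiv i
      (X 0 ^ 2 * X 1 + X 1 ^ 2 * X 2 + X 2 ^ 2 * X 0 + X 0 * X 3 + X 1 * X 2 * X 3 :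
        MvPolynomial (Fin 4) k)) = 0 := by
  simp only [map_add, pderiv_mul, pderiv_pow, map_mul, map_pow, eval_X, Pi.zero_apply,
    mul_zero, zero_mul, add_zero, ne_eq, OfNat.ofNat_ne_zero, not_false_eq_true, zero_pow]

/-- The ideal of the origin is the kernel of evaluation at `0`:
`ker (eval 0) = (X₀, X₁, X₂, X₃)` in `k[X₀, X₁, X₂, X₃]` (`MvPolynomial.eval_zero : eval 0 = constantCoeff`
and `Fedder.span_range_X_eq_ker`). [folklore] -/
theorem ker_eval_zero_eq_span_range_X (k : Type) [Field k] :
    RingHom.ker (eval (0 : Fin 4 → k)) = Ideal.span (Set.range (X : Fin 4 → MvPolynomial (Fin 4) k)) := by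
  rw [MvPolynomial.eval_zero, Fedder.span_range_X_eq_ker]

/-- **Threefold calibration: the new point is singular.** For a field `k` (any characteristic),
`g₃ = X₀²X₁ + X₁²X₂ + X₂²X₀ + X₀X₃ + X₁X₂X₃` and a prime `Q` of `k[X₀, X₁, X₂, X₃]/(g₃)` lying over the
origin `(X₀, X₁, X₂, X₃)`, the local ring `(k[X]/(g₃))_Q` is not a regular local ring: `g₃ ≠ 0`
(`ThreefoldChart3Points.g3_mem_and_ne_zero`), `g₃(0) = 0`, `∇g₃(0) = 0`, and the Jacobian criterion,
singular direction (`not_isRegularLocalRing_localization_of_pderiv_eval_eq_zero`).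
[cite: Hartshorne1977, I Thm. 5.1] -/
theorem stub_threefoldChart3OriginSingular : ∀ (k : Type) [Field k] (g₃ : MvPolynomial (Fin 4) k),
    g₃ = MvPolynomial.X 0 ^ 2 * MvPolynomial.X 1 + MvPolynomial.X 1 ^ 2 * MvPolynomial.X 2 + MvPolynomial.X 2 ^ 2 * MvPolynomial.X 0 + MvPolynomial.X 0 * MvPolynomial.X 3 + MvPolynomial.X 1 * MvPolynomial.X 2 * MvPolynomial.X 3 →
    ∀ (Q : Ideal (MvPolynomial (Fin 4) k ⧸ Ideal.span {g₃})) [Q.IsPrime],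
      Q.comap (Ideal.Quotient.mk (Ideal.span {g₃})) =
        Ideal.span (Set.range (MvPolynomial.X : Fin 4 → MvPolynomial (Fin 4) k)) →
      ¬ IsRegularLocalRing (Localization.AtPrime Q) := by
  intro k _ g₃ hg Q _ hQ
  classical
  subst hg
  exact Literature.AlgebraicGeometry.Resolution.not_isRegularLocalRing_localization_of_pderiv_eval_eq_zero
    (0 : Fin 4 → k) (ThreefoldChart3Points.g3_mem_and_ne_zero k).2 (eval_zero_g3 k)
    (eval_zero_pderiv_g3 k) Q (hQ.trans (ker_eval_zero_eq_span_range_X k).symm)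

end Summit.ResolutionOfSingularities.ResolutionOfSingularities.Theorems.FInjectiveMacaulayfication.ThreefoldChart3OriginSingular

end
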